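import Literature.AlgebraicGeometry.Resolution.ProjectiveModelsDomination
import Literature.AlgebraicGeometry.Resolution.ProjectiveResolutionProofs
import Mathlib.Analysis.Complex.Polynomial.Basic
import HarnessLib

/-!
# A common smooth projective roof of two smooth projective models of one function field
# (crux C2 `GenericDivisibilityBounded`, stmt-HodgeConjecture-18467, line `finite-level-bootstrap`)

Registered sub-goal `stub_smoothRoofOfProjModels` (lead c6, wave 2). Sorry-free, definition-free.

Two projective models `M₁`, `M₂` of one field `K/ℂ` (the tree's
`Literature.AlgebraicGeometry.Resolution.ProjModel ℂ K`: an integral projective `ℂ`-scheme with a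
`K`-point identifying `K` with its function field) whose underlying varieties are smooth
projective of dimension `n` are dominated by ONE smooth projective `n`-fold `Y` through BIRATIONAL
`ℂ`-morphisms `σ₁ : Y ⟶ M₁.toOver`, `σ₂ : Y ⟶ M₂.toOver`. Together with the (landed) two-sided
invariance of the heart `LevelClean ℓ s p X`, of C2 at `X` and of the open locus
`{N¹H^{2p} ≠ H^{2p}}` under birational MORPHISMS of smooth projective `2p`-folds, this makes all
three invariants of the FUNCTION FIELD `ℂ(X)/ℂ`.

## The argument

The JOIN `N := M₁.join M₂` (Zariski–Samuel II, Ch. VI §17; the tree's `ProjModel.join`, the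
closure of the diagonal `K`-point in `M₁ ×_ℂ M₂`) is a projective model of `K/ℂ` dominating both:
`joinFst : N ⟶ M₁`, `joinSnd : N ⟶ M₂` are morphisms of models, hence birational
(`ProjModel.Hom.isBirational`: a morphism of projective models of the same field is an
isomorphism over a non-empty open). Projective HIRONAKA, a THEOREM of the tree over the
algebraically closed characteristic-zero field `ℂ` (`Resolution.Hironaka1964_projective_holds`,
Kollár 2007, Thm. 3.27), resolves the integral projective `N`: `π : Y ⟶ N.toOver` birational from
a smooth projective `Y` of dimension `d = dim N`. Then `σᵢ := π ≫ joinᵢ` are birational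
(`IsBirational.comp`), and `d = n` because a birational morphism of integral schemes locally of
finite type over a field preserves the dimension — source and target contain a common non-empty
open, which computes the dimension of either (Görtz–Wedhorn I, Thm. 5.22 (3);
`height_genericPoint_eq_of_isBirational` below) — while `dim M₁ = n` (`M₁` is smooth of relative
dimension `n` over `ℂ`, `Motives.topologicalKrullDim_eq_of_smoothOfRelativeDimension`).

## Main results

* `height_genericPoint_eq_of_isBirational` — a birational morphism `X' ⟶ X` of integral schemes
  locally of finite type over a field preserves the height of the generic point (the dimension).
* `ProjModel.height_genericPoint_eq_of_hom` — two projective models of one field related by a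
  morphism of models have the same dimension.
* `stub_smoothRoofOfProjModels` — the registered signature, verbatim.

References: [ZariskiSamuel1960] Ch. VI §17 (models, domination, the join); [Kollar2007] Thm. 3.27
(p. 126) (projective resolution); [GortzWedhorn2020] Thm. 5.22 (3) (dimension of a non-empty
open); [Hartshorne1977] II Ex. 3.20 (dimension theory of integral schemes of finite type over a
field).
-/

set_option linter.dupNamespace false

noncomputable section

namespace Summit.HodgeConjecture.HodgeConjecture.Theorems

open CategoryTheory AlgebraicGeometry
open Literature.AlgebraicGeometry.Motives

universe u

/-! ### Birational morphisms preserve the dimension -/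

/-- **A birational morphism of integral schemes locally of finite type over a field preserves the
height of the generic point** (the dimension): if `π : X' ⟶ X` is an isomorphism over the dense
open `U ⊆ X` with dense preimage, then `π⁻¹(U) ≅ U` is a non-empty open of both `X'` and `X`, and
a non-empty open of an integral scheme locally of finite type over a field has the dimension of
the whole scheme (Görtz–Wedhorn I, Thm. 5.22 (3); the tree's `Resolution.topologicalKrullDim_opens_eq`);
the height of the generic point of an irreducible scheme is its dimension
(`Motives.Scheme.height_genericPoint`; Hartshorne II Ex. 3.20).
[cite: GortzWedhorn2020, Thm. 5.22 (3)] [cite: Hartshorne1977, II Ex. 3.20] -/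
theorem height_genericPoint_eq_of_isBirational {k : Type u} [Field k] {X' X : Scheme.{u}}
    [IsIntegral X'] [IsIntegral X] (f : X ⟶ Spec (.of k)) [LocallyOfFiniteType f]
    (π : X' ⟶ X) [LocallyOfFiniteType (π ≫ f)]
    (hπ : Literature.AlgebraicGeometry.Resolution.IsBirational π) :
    Order.height (genericPoint X') = Order.height (genericPoint X) := by
  obtain ⟨U, hU, hU', hiso⟩ := hπ
  have h1 := Literature.AlgebraicGeometry.Resolution.topologicalKrullDim_opens_eq f U hU.nonempty
  have h2 := Literature.AlgebraicGeometry.Resolution.topologicalKrullDim_opens_eq (π ≫ f) (π ⁻¹ᵁ U)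
    hU'.nonempty
  have h3 : topologicalKrullDim ((π ⁻¹ᵁ U : X'.Opens) : Scheme.{u}) =
      topologicalKrullDim ((U : X.Opens) : Scheme.{u}) :=
    IsHomeomorph.topologicalKrullDim_eq _ (Scheme.homeoOfIso (asIso (π ∣_ U))).isHomeomorph
  have h : (Order.height (genericPoint X') : WithBot ℕ∞) = Order.height (genericPoint X) := by
    rw [Scheme.height_genericPoint X', Scheme.height_genericPoint X, ← h2, h3, h1]
  exact_mod_cast h

/-- **Two projective models of one field related by a morphism of models have the same
dimension**: a morphism `φ : N ⟶ M` of projective models of `K/k` is birational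
(`ProjModel.Hom.isBirational`; Zariski–Samuel II, Ch. VI §17: both models have function field
`K`), both are integral of finite type over `k`, and `height_genericPoint_eq_of_isBirational`
applies. [cite: ZariskiSamuel1960, Ch. VI §17] -/
theorem ProjModel.height_genericPoint_eq_of_hom {k K : Type u} [Field k] [Field K] [Algebra k K]
    {N M : Literature.AlgebraicGeometry.Resolution.ProjModel k K} (φ : N.Hom M) :
    Order.height (genericPoint N.X) = Order.height (genericPoint M.X) := by
  haveI : LocallyOfFiniteType (φ.f ≫ M.π) := by rw [φ.f_π]; infer_instance
  exact height_genericPoint_eq_of_isBirational M.π φ.f φ.isBirational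

/-! ### The registered sub-goal -/

/-- **Registered sub-goal `stub_smoothRoofOfProjModels` of stmt-HodgeConjecture-18467 (lead c6,
line `finite-level-bootstrap`): two smooth projective models of one function field have a common
smooth projective birational roof.** For projective models `M₁`, `M₂` of a field `K/ℂ` whose
underlying `ℂ`-varieties are smooth projective of dimension `n`, there are a smooth projective
`n`-fold `Y` over `ℂ` and birational `ℂ`-morphisms `σ₁ : Y ⟶ M₁.toOver`, `σ₂ : Y ⟶ M₂.toOver`.
Proof: the join `N := M₁.join M₂` (Zariski–Samuel II, Ch. VI §17) dominates both models through
the morphisms of models `joinFst`, `joinSnd`, which are birational (`ProjModel.Hom.isBirational`);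
projective Hironaka over `ℂ` (`Resolution.Hironaka1964_projective_holds`; Kollár 2007, Thm. 3.27,
PROVED in the tree) gives `π : Y ⟶ N.toOver` birational with `Y` smooth projective of dimension
`d = dim N`; compose (`IsBirational.comp`); and `d = dim N = dim M₁ = n` by
`ProjModel.height_genericPoint_eq_of_hom joinFst` and smoothness of relative dimension `n` of
`M₁ → Spec ℂ` (`Motives.topologicalKrullDim_eq_of_smoothOfRelativeDimension`,
`Motives.Scheme.height_genericPoint`). The hypothesis on `M₂` is idle. Statement: the
skeleton's, verbatim.
[cite: ZariskiSamuel1960, Ch. VI §17] [cite: Kollar2007, Thm. 3.27 (p. 126)]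
[cite: GortzWedhorn2020, Thm. 5.22 (3)] -/
theorem stub_smoothRoofOfProjModels :
    ∀ (K : Type) [Field K] [Algebra ℂ K]
      (M₁ M₂ : Literature.AlgebraicGeometry.Resolution.ProjModel ℂ K) (n : ℕ),
      IsSmoothProjective n M₁.toOver → IsSmoothProjective n M₂.toOver →
      ∃ (Y : SchemeOver ℂ) (σ₁ : Y ⟶ M₁.toOver) (σ₂ : Y ⟶ M₂.toOver),
        IsSmoothProjective n Y ∧
        Literature.AlgebraicGeometry.Resolution.IsBirational σ₁.left ∧
        Literature.AlgebraicGeometry.Resolution.IsBirational σ₂.left := by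
  intro K _ _ M₁ M₂ n h₁ _
  -- the join `N` and its two dominations `φ₁ : N ⟶ M₁`, `φ₂ : N ⟶ M₂`, as `ℂ`-morphisms `τ₁`, `τ₂`
  let N : Literature.AlgebraicGeometry.Resolution.ProjModel ℂ K := M₁.join M₂
  let φ₁ : N.Hom M₁ := Literature.AlgebraicGeometry.Resolution.ProjModel.joinFst M₁ M₂
  let φ₂ : N.Hom M₂ := Literature.AlgebraicGeometry.Resolution.ProjModel.joinSnd M₁ M₂
  let τ₁ : N.toOver ⟶ M₁.toOver := Over.homMk φ₁.f φ₁.f_π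
  let τ₂ : N.toOver ⟶ M₂.toOver := Over.homMk φ₂.f φ₂.f_π
  -- projective Hironaka on the integral projective `ℂ`-scheme `N`
  haveI : IsIntegral N.toOver.left := N.isIntegral'
  obtain ⟨d, Y, π, hY, hπ, hd⟩ :=
    Literature.AlgebraicGeometry.Resolution.Hironaka1964_projective_holds ℂ N.toOver
      N.isProjectiveOver
  -- `d = dim N = dim M₁ = n`
  have hdN : Order.height (genericPoint N.X) = (d : ℕ∞) := hd
  have hnM : Order.height (genericPoint M₁.X) = (n : ℕ∞) := by
    haveI : SmoothOfRelativeDimension n M₁.π := h₁.smoothOfRelativeDimension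
    have h0 := Scheme.height_genericPoint M₁.X
    rw [topologicalKrullDim_eq_of_smoothOfRelativeDimension M₁.π n] at h0
    exact WithBot.coe_injective (h0.trans (WithBot.coe_natCast n).symm)
  obtain rfl : d = n := by
    rw [ProjModel.height_genericPoint_eq_of_hom φ₁, hnM] at hdN
    exact_mod_cast hdN.symm
  -- the roof `M₁ ⟵ Y ⟶ M₂`
  refine ⟨Y, π ≫ τ₁, π ≫ τ₂, hY, ?_, ?_⟩
  · show Literature.AlgebraicGeometry.Resolution.IsBirational (π.left ≫ φ₁.f)
    exact hπ.comp φ₁.isBirational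
  · show Literature.AlgebraicGeometry.Resolution.IsBirational (π.left ≫ φ₂.f)
    exact hπ.comp φ₂.isBirational

end Summit.HodgeConjecture.HodgeConjecture.Theorems

end
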